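import Summits.AnomalousDissipation.AnomalousDissipation.Theorems.SawtoothPulseCascadeK1LocalisedCascadeHalfStepCornerZone
import Summits.AnomalousDissipation.AnomalousDissipation.Theorems.SawtoothPulseCascadeK1LocalisedCascadeCornerTraceGeomFibre

/-!
# K1loc — helper: THE H HALF-STEP IN ALL-ORDERS CORNER-TRACE GRADE, TRACKED PART («CT-GEO» half-step 1/2; F-p1g9-1)

Port of `…HalfStepHCTS.sum_window_sq_norm_hstep_ct_split_le` (coordinate swap `0 ↔ 1` of `…HalfStepVCTGTracked`) (same frame, same proof skeleton: coefficient identity on each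
fibre, exact chirp + rounding off the corner zones + pass-through) with the per-fibre kernel replaced by the all-orders bound
`…CornerTraceGeomSum(Neg).cornerTraceGeom_sum_sq_le(_neg)` and its closed-form scalars `…CornerTraceGeomTau`.  The window is a
box: `|k₀| ≤ K` on fibres `|k₁| ≥ n₀` with `K + L + D ≤ n₀G` (the gap at the bottom fibre) and `K + 1 ≤ n₀G − Λ`; the corner-trace
inputs are INDEXED BY THE ORDER: `Θ^±` bound `Σ_{n ≷ 0} |Σ_l χ_l l^i 𝓕b(l,n) e^{2πily}|² ≤ Λ^{2i}Θ^±` for all `i < p` and all `y`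
(for the box trapezoid `Λ = L_supp − 1`, `…TraceKernelsDeriv`).  This file: the TRACKED
part `T = χ(D₀)b` (steps (1)–(7) of the CTS proof): `Σ_{k∈W} |𝓕(T∘Φ_H)(k)|² ≤ (√(c₁(Θ⁺+Θ⁻) + c₂E) + √(η²E + 8Mδ_j(Θ⁺+Θ⁻)/π))²`,
  `c₁ = (1+ε)(N²/π²)·(8λ′²/(λ′²−K²)² + 8(K+½)/(N(λ′²−(K+½)²)))`, `λ′ = n₀G − Λ` (NO residue term),
  `c₂ = (1+ε⁻¹)(N²/π²)·(4/D²)(1/S^{2p} + 1/(NS^{2p−1}))·(2L/N+1)L^{2p}`, `S = D + L` (the order-`p` remainder, negligible for large `p`).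
The pass-through part and the assembly are `…HalfStepHCTG`.  No definitions; nothing about the crux. [cite: Grafakos2014, Prop. 3.1.2 (5), Prop. 3.2.7 (3), §3.1.3] [problem: turb]
-/

-- `Summit.<Summit>.<Problem>`: single-conjunct summit, the duplicate namespace segment is deliberate.
set_option linter.dupNamespace false

namespace Summit.AnomalousDissipation.AnomalousDissipation.Theorems.SawtoothPulseCascade.K1Window

open MeasureTheory Set Filter Topology UnitAddTorus Function Complex Metric
open scoped Real ENNReal
open Literature.Analysis Literature.Analysis.FunctionSpaces Literature.Analysis.FunctionSpaces.Torus Literature.Analysis.FluidPDE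
open Literature.Analysis.FluidPDE.ShearStage
open Literature.Analysis.FluidPDE.SawtoothCascade Literature.Analysis.FluidPDE.SawtoothCascade.CascadeParams
open Summit.AnomalousDissipation.AnomalousDissipation.Theorems.SawtoothPulseCascade.K1Start
open Summit.AnomalousDissipation.AnomalousDissipation.Theorems.SawtoothPulseCascade.K1Flat

set_option maxHeartbeats 1600000 in
/-- **THE H HALF-STEP, ALL-ORDERS CORNER-TRACE GRADE** (see the file header).  Data: integer strain `γ = G`, continuous input `b`
with summable coefficients, box window `W` (`|k₀| ≤ K`, `|k₁| ≥ n₀`), source multiplier `χ` supported in `Sχ ⊂ [−L, L]` with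
`|χ| ≤ 1`, gap `D ≥ 1` with `K + L + D ≤ n₀G`, order `p ≥ 1`, weight base `Λ > 0` with `K + 1 ≤ n₀G − Λ`, indexed sign-split
corner-trace bounds `Θ⁺, Θ⁻` (orders `i < p`, all real `y`), tracked energy bound `E`, zone parameter `M ≥ 1` with `Mδ_j < π/2`,
rounding amplitude `η`, `ε > 0`.  Conclusion: `Σ_{k∈W}|𝓕(b∘Φ_H)(k)|² ≤ (√J_CTG + √J_round + √PT)²`.
[cite: Grafakos2014, Prop. 3.1.2 (5), Prop. 3.2.7 (3)] -/
theorem sum_window_sq_norm_tracked_hstep_ctg_le (P : CascadeParams) {G : ℕ} (hγ : P.γ = G) (hδ₀ : 0 < P.δ₀) (hd : 0 < P.d)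
    (hN₀ : 1 ≤ P.N₀) (hρN : 1 ≤ P.ρN) (j : ℕ)
    {b : UnitAddTorus (Fin 2) → ℂ} (hb : Continuous b) (hbs : Summable fun k => ‖mFourierCoeff b k‖)
    (W : Finset (Fin 2 → ℤ)) (χ : ℤ → ℂ) (Sχ : Finset ℤ) (hχS : ∀ l, l ∉ Sχ → χ l = 0) (hχ1 : ∀ l, ‖χ l‖ ≤ 1)
    {L D K n₀ : ℕ} (hSL : ∀ l ∈ Sχ, |l| ≤ L) (hD : 0 < D) (hWK : ∀ k ∈ W, |k 1| ≤ (K : ℤ))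
    (hWn₀ : ∀ k ∈ W, (n₀ : ℤ) ≤ |k 0|) (hKD : (K : ℤ) + L + D ≤ (n₀ : ℤ) * G)
    {p : ℕ} (hp : 1 ≤ p) {Λ : ℝ} (hΛ : 0 < Λ) (hedge : (K : ℝ) + 1 ≤ (n₀ : ℝ) * G - Λ)
    {Θp Θm E M η ε : ℝ} (hε : 0 < ε)
    (hΘp : ∀ i ∈ Finset.range p, ∀ y : ℝ, ∑ n ∈ (W.image (fun k => k 0)).filter (fun n => 0 < n),
      ‖∑ l ∈ Sχ, χ l * (l : ℂ) ^ i * mFourierCoeff b ![n, l] * cexp (2 * π * I * l * y)‖ ^ 2 ≤ Λ ^ (2 * i) * Θp)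
    (hΘm : ∀ i ∈ Finset.range p, ∀ y : ℝ, ∑ n ∈ (W.image (fun k => k 0)).filter (fun n => n < 0),
      ‖∑ l ∈ Sχ, χ l * (l : ℂ) ^ i * mFourierCoeff b ![n, l] * cexp (2 * π * I * l * y)‖ ^ 2 ≤ Λ ^ (2 * i) * Θm)
    (hE : ∑ n ∈ W.image (fun k => k 0), ∑ l ∈ Sχ, ‖χ l * mFourierCoeff b ![n, l]‖ ^ 2 ≤ E)
    (hM : 1 ≤ M) (hMδ : M * P.δ j < π / 2)
    (hη : ∀ k ∈ W, 2 * π * |((k 0 * G : ℤ) : ℝ)| * (Real.exp (-(M ^ 2 / 2)) / (2 * P.N j)) ≤ η) :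
    ∑ k ∈ W, ‖mFourierCoeff ((fun x => ∑ l ∈ Sχ, χ l * ∫ s : UnitAddCircle, (fourier (-l) s : ℂ) • b (x + Pi.single (1 : Fin 2) s)) ∘
        shearMap 0 1 (amp ⟨P.U j, P.U_periodic j, P.contDiff_U (P.δ_pos hδ₀ hd j)⟩ P.γ)) k‖ ^ 2 ≤
      (Real.sqrt ((1 + ε) * ((P.N j : ℝ) ^ 2 / π ^ 2) *
              (8 * ((n₀ : ℝ) * G - Λ) ^ 2 / (((n₀ : ℝ) * G - Λ) ^ 2 - (K : ℝ) ^ 2) ^ 2 +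
                8 * ((K : ℝ) + 1 / 2) / (P.N j * (((n₀ : ℝ) * G - Λ) ^ 2 - ((K : ℝ) + 1 / 2) ^ 2))) * (Θp + Θm) +
            (1 + ε⁻¹) * ((P.N j : ℝ) ^ 2 / π ^ 2) * (4 / (D : ℝ) ^ 2 * (1 / ((D : ℝ) + L) ^ (2 * p) +
              1 / (P.N j * ((D : ℝ) + L) ^ (2 * p - 1)))) * ((2 * (L : ℝ) / P.N j + 1) * (L : ℝ) ^ (2 * p)) * E) +
          Real.sqrt (η ^ 2 * E + 8 * M * P.δ j / π * (Θp + Θm))) ^ 2 := by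
  classical
  -- the window gap on every fibre
  have hWD : ∀ k ∈ W, |k 1| + L + D ≤ |k 0| * G := by
    intro k hk
    have h1 := hWK k hk; have h2 := hWn₀ k hk
    have hG0 : (0 : ℤ) ≤ G := Int.natCast_nonneg G
    nlinarith
  -- the order-zero traces (the zone term)
  have hΘp0 : ∀ y : ℝ, ∑ n ∈ (W.image (fun k => k 0)).filter (fun n => 0 < n),
      ‖∑ l ∈ Sχ, χ l * mFourierCoeff b ![n, l] * cexp (2 * π * I * l * y)‖ ^ 2 ≤ Θp := by
    intro y
    have h := hΘp 0 (Finset.mem_range.mpr hp) y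
    simpa only [pow_zero, mul_one, mul_zero, one_mul] using h
  have hΘm0 : ∀ y : ℝ, ∑ n ∈ (W.image (fun k => k 0)).filter (fun n => n < 0),
      ‖∑ l ∈ Sχ, χ l * mFourierCoeff b ![n, l] * cexp (2 * π * I * l * y)‖ ^ 2 ≤ Θm := by
    intro y
    have h := hΘm 0 (Finset.mem_range.mpr hp) y
    simpa only [pow_zero, mul_one, mul_zero, one_mul] using h
  obtain ⟨hπ, h10⟩ : 0 < π ∧ (0 : Fin 2) ≠ 1 := ⟨Real.pi_pos, by decide⟩
  have hN : P.N j ≠ 0 := (N_pos P hN₀ hρN j).ne'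
  have hNpos : 0 < P.N j := Nat.pos_of_ne_zero hN
  have hNr : (0 : ℝ) < P.N j := by exact_mod_cast hNpos
  have hI : ∀ {f : UnitAddCircle → ℝ}, Continuous f → Integrable f := fun hf =>
    hf.integrable_of_hasCompactSupport (HasCompactSupport.of_compactSpace _)
  set Ψ : ShearProfile := amp ⟨P.U j, P.U_periodic j, P.contDiff_U (P.δ_pos hδ₀ hd j)⟩ P.γ with hΨ
  -- the input cut-off and its complement
  set T : UnitAddTorus (Fin 2) → ℂ := fun x => ∑ l ∈ Sχ, χ l *
    ∫ s : UnitAddCircle, (fourier (-l) s : ℂ) • b (x + Pi.single (1 : Fin 2) s) with hT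
  have hTc : Continuous T := continuous_finsetSum _ fun l _ => continuous_const.mul (continuous_twistedAxisAvg hb 1 l)
  have hTcoef : ∀ k, mFourierCoeff T k = χ (k 1) * mFourierCoeff b k := fun k => mFourierCoeff_axisCutoff hb 1 hχS k
  have hTs : Summable fun k => ‖mFourierCoeff T k‖ := by
    refine Summable.of_nonneg_of_le (fun k => norm_nonneg _) (fun k => ?_) hbs
    rw [hTcoef k, norm_mul]
    exact mul_le_of_le_one_left (norm_nonneg _) (hχ1 _)
  -- the exact chirps and the rounded twists
  set g0 : ℤ → UnitAddCircle → ℂ := fun n => (periodic_exactChirpFun (P.N j) (n * G)).lift with hg0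
  have hg0c : ∀ n, Continuous (g0 n) := fun n => (continuous_exactChirp_lift (P.N j) (n * G)).1
  have hg0t : ∀ n (t : ℝ), g0 n (t : UnitAddCircle) =
      Complex.exp (-(2 * π * I * ((n * G : ℤ)) * ((tri (2 * π * P.N j * t) / (2 * π * P.N j) : ℝ) : ℂ))) :=
    fun n t => (continuous_exactChirp_lift (P.N j) (n * G)).2 t
  have hg01 : ∀ n bb, ‖g0 n bb‖ ≤ 1 := by
    intro n bb
    obtain ⟨t, rfl⟩ := QuotientAddGroup.mk_surjective bb
    rw [hg0t]; exact norm_exp_chirp_le _ _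
  have htw1 : ∀ n bb, ‖twist Ψ n bb‖ ≤ 1 := fun n bb => (norm_twist Ψ n bb).le
  have hon : ∀ n (x : UnitAddCircle), ‖twist Ψ n x - g0 n x‖ ≤ 2 := fun n x =>
    (norm_sub_le _ _).trans (by linarith [htw1 n x, hg01 n x])
  -- the corner zones (`…HalfStepCornerZone`)
  obtain ⟨Z, hZm, hZvol, hoffZ'⟩ := exists_cornerZone P hγ hδ₀ hd hN₀ hρN j W 0 hM hMδ hη
  have hoffZ : ∀ k ∈ W, ∀ x, x ∉ Z → ‖twist Ψ (k 0) x - g0 (k 0) x‖ ≤ η := fun k hk x hx => by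
    simpa only [hg0, hΨ] using hoffZ' k hk x hx
  have hM0 : (0 : ℝ) ≤ M := by linarith
  -- fibres of the window
  set F : Finset ℤ := W.image fun k => k 0 with hF
  have hmaps : ∀ k ∈ W, k 0 ∈ F := fun k hk => Finset.mem_image_of_mem _ hk
  obtain ⟨Wn, hWn⟩ : ∃ Wn : ℤ → Finset ℤ, ∀ n, Wn n = (W.filter fun k => k 0 = n).image fun k => k 1 :=
    ⟨_, fun _ => rfl⟩
  have hWn' : ∀ n, ∀ k₀ ∈ Wn n, ∃ k ∈ W, k 0 = n ∧ k 1 = k₀ := by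
    intro n k₀ hk₀; rw [hWn] at hk₀
    obtain ⟨k, hk, rfl⟩ := Finset.mem_image.mp hk₀
    obtain ⟨hkW, hkn⟩ := Finset.mem_filter.mp hk
    exact ⟨k, hkW, hkn, rfl⟩
  have hFW : ∀ n ∈ F, ∃ k ∈ W, k 0 = n := fun n hn => by
    obtain ⟨k, hk, rfl⟩ := Finset.mem_image.mp hn
    exact ⟨k, hk, rfl⟩
  have hnG : ∀ n : ℤ, ((n.natAbs * G : ℕ) : ℤ) = |n| * G := fun n => by rw [Nat.cast_mul, Int.natCast_natAbs]
  have hF0 : ∀ n ∈ F, n ≠ 0 := fun n hn h0 => by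
    obtain ⟨k, hkW, hkn⟩ := hFW n hn
    have hkD := hWD k hkW
    rw [hkn, h0, abs_zero, zero_mul] at hkD
    have hD1 : (1 : ℤ) ≤ D := by exact_mod_cast hD
    linarith [abs_nonneg (k 1)]
  have hFsplit : ∀ f : ℤ → ℝ, ∑ n ∈ F, f n = ∑ n ∈ F.filter (fun n => 0 < n), f n + ∑ n ∈ F.filter (fun n => n < 0), f n :=
    fun f => by
      rw [← Finset.sum_filter_add_sum_filter_not F (fun n => 0 < n), Finset.filter_congr (p := fun n => ¬0 < n)
        (q := fun n => n < 0) (fun n hn => by have := hF0 n hn; omega)]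
  -- (1) the coefficient identity on a fibre
  have hcoefT : ∀ k ∈ W, mFourierCoeff (T ∘ shearMap 0 1 Ψ) k =
      fourierCoeff (fun x : UnitAddCircle => twist Ψ (k 0) x *
        ∑ l ∈ Sχ, χ l * mFourierCoeff b ![k 0, l] * fourier l x) (k 1) := by
    intro k _
    rw [mFourierCoeff_comp_shearMap hTc hTs h10 Ψ k, fourierCoeff_mul_trigPoly (continuous_twist Ψ _) _ Sχ (k 1)]
    have hzero : ∀ m : ℤ, m ∉ Sχ.image (fun l => k 1 - l) →
        fourierCoeff (twist Ψ (k 0)) m * mFourierCoeff T (k - Pi.single 1 m) = 0 := by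
      intro m hm
      rw [hTcoef]
      have e0 : (k - Pi.single (1 : Fin 2) m : Fin 2 → ℤ) 1 = k 1 - m := by simp
      have hnot : k 1 - m ∉ Sχ := fun hmem => hm (Finset.mem_image.mpr ⟨k 1 - m, hmem, by ring⟩)
      rw [e0, hχS _ hnot, zero_mul, mul_zero]
    rw [tsum_eq_sum (s := Sχ.image fun l => k 1 - l) hzero,
      Finset.sum_image fun l _ l' _ h => by linarith]
    refine Finset.sum_congr rfl fun l _ => ?_
    have e2 : k - Pi.single (1 : Fin 2) (k 1 - l) = ![k 0, l] := by
      funext i; fin_cases i <;> simp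
    have e3 : (![k 0, l] : Fin 2 → ℤ) 1 = l := rfl
    rw [hTcoef, e2, e3]; ring
  -- (2) the window, fibre by fibre
  have hTsum : ∑ k ∈ W, ‖mFourierCoeff (T ∘ shearMap 0 1 Ψ) k‖ ^ 2 =
      ∑ n ∈ F, ∑ k₀ ∈ Wn n, ‖fourierCoeff (fun x : UnitAddCircle => twist Ψ n x *
        ∑ l ∈ Sχ, χ l * mFourierCoeff b ![n, l] * fourier l x) k₀‖ ^ 2 := by
    rw [← Finset.sum_fiberwise_of_maps_to hmaps]
    refine Finset.sum_congr rfl fun n _ => ?_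
    rw [hWn n, Finset.sum_image ?_]
    · refine Finset.sum_congr rfl fun k hk => ?_
      obtain ⟨hkW, hkn⟩ := Finset.mem_filter.mp hk
      rw [hcoefT k hkW, hkn]
    · intro k hk k' hk' h
      obtain ⟨-, h1⟩ := Finset.mem_filter.mp (Finset.mem_coe.mp hk)
      obtain ⟨-, h1'⟩ := Finset.mem_filter.mp (Finset.mem_coe.mp hk')
      funext i; fin_cases i; exacts [h1.trans h1'.symm, h]
  -- (3) abbreviations for the per-fibre quantities
  obtain ⟨e, he⟩ : ∃ e : ℤ → ℝ, ∀ n, e n = ∑ l ∈ Sχ, ‖χ l * mFourierCoeff b ![n, l]‖ ^ 2 := ⟨_, fun n => rfl⟩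
  obtain ⟨pos, hpos⟩ : ∃ pos : ℕ → ℤ → ℝ, ∀ i n, pos i n = if 0 < n then
      ∑ r ∈ Finset.range (P.N j), ‖∑ l ∈ Sχ, χ l * mFourierCoeff b ![n, l] * (l : ℂ) ^ i *
          cexp (2 * π * I * l * ((4 * (r : ℝ) - 1) / (4 * P.N j)))‖ ^ 2 +
        ∑ r ∈ Finset.range (P.N j), ‖∑ l ∈ Sχ, χ l * mFourierCoeff b ![n, l] * (l : ℂ) ^ i *
          cexp (2 * π * I * l * ((4 * (r : ℝ) + 1) / (4 * P.N j)))‖ ^ 2 else 0 := ⟨_, fun i n => rfl⟩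
  obtain ⟨neg, hneg⟩ : ∃ neg : ℕ → ℤ → ℝ, ∀ i n, neg i n = if n < 0 then
      ∑ r ∈ Finset.range (P.N j), ‖∑ l ∈ Sχ, χ l * mFourierCoeff b ![n, l] * (l : ℂ) ^ i *
          cexp (2 * π * I * l * (-((4 * (r : ℝ) - 1) / (4 * P.N j))))‖ ^ 2 +
        ∑ r ∈ Finset.range (P.N j), ‖∑ l ∈ Sχ, χ l * mFourierCoeff b ![n, l] * (l : ℂ) ^ i *
          cexp (2 * π * I * l * (-((4 * (r : ℝ) + 1) / (4 * P.N j))))‖ ^ 2 else 0 := ⟨_, fun i n => rfl⟩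
  obtain ⟨ρ, hρ⟩ : ∃ ρ : ℤ → ℝ, ∀ n, ρ n =
      ∫ x in Z, ‖∑ l ∈ Sχ, χ l * mFourierCoeff b ![n, l] * (fourier l x : ℂ)‖ ^ 2 := ⟨_, fun n => rfl⟩
  -- the scalars
  set lam' : ℝ := (n₀ : ℝ) * G - Λ with hlam'
  obtain ⟨τtot, hτtot⟩ : ∃ τtot : ℝ, τtot = 8 * lam' ^ 2 / (lam' ^ 2 - (K : ℝ) ^ 2) ^ 2 +
      8 * ((K : ℝ) + 1 / 2) / (P.N j * (lam' ^ 2 - ((K : ℝ) + 1 / 2) ^ 2)) := ⟨_, rfl⟩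
  obtain ⟨σξ, hσξ⟩ : ∃ σξ : ℝ, σξ = 4 / (D : ℝ) ^ 2 * (1 / ((D : ℝ) + L) ^ (2 * p) + 1 / (P.N j * ((D : ℝ) + L) ^ (2 * p - 1))) :=
    ⟨_, rfl⟩
  obtain ⟨Mp, hMpdef⟩ : ∃ Mp : ℝ, Mp = (2 * (L : ℝ) / P.N j + 1) * (L : ℝ) ^ (2 * p) := ⟨_, rfl⟩
  obtain ⟨cA, hcA⟩ : ∃ cA : ℝ, cA = (1 + ε) * ((P.N j : ℝ) / (2 * π ^ 2)) := ⟨_, rfl⟩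
  obtain ⟨c₂, hc₂⟩ : ∃ c₂ : ℝ, c₂ = (1 + ε⁻¹) * ((P.N j : ℝ) ^ 2 / π ^ 2) * σξ * Mp := ⟨_, rfl⟩
  obtain ⟨c₁, hc₁⟩ : ∃ c₁ : ℝ, c₁ = (1 + ε) * ((P.N j : ℝ) ^ 2 / π ^ 2) * τtot := ⟨_, rfl⟩
  have hσξ0 : 0 ≤ σξ := by rw [hσξ]; positivity
  have hMp0 : 0 ≤ Mp := by rw [hMpdef]; positivity
  have hcA0 : 0 ≤ cA := by rw [hcA]; positivity
  have hc₂0 : 0 ≤ c₂ := by rw [hc₂]; positivity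
  have he0 : ∀ n, 0 ≤ e n := fun n => by rw [he]; positivity
  have hpos0 : ∀ i n, 0 ≤ pos i n := fun i n => by rw [hpos]; split_ifs <;> positivity
  have hneg0 : ∀ i n, 0 ≤ neg i n := fun i n => by rw [hneg]; split_ifs <;> positivity
  have hρ0 : ∀ n, 0 ≤ ρ n := fun n => by rw [hρ]; exact integral_nonneg fun x => sq_nonneg _
  have hΘ0 : 0 ≤ Θp + Θm :=
    add_nonneg (le_trans (Finset.sum_nonneg fun n _ => sq_nonneg _) (hΘp0 0))
      (le_trans (Finset.sum_nonneg fun n _ => sq_nonneg _) (hΘm0 0))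
  -- the trace scalars `τ_i` at the bottom lobe `λ₀ = n₀G`
  have hedge' : (K : ℝ) + 1 ≤ ((n₀ * G : ℕ) : ℝ) - Λ := by push_cast; exact hedge
  obtain ⟨τ, hτ, hτsum⟩ := cornerTraceGeom_tau_le hNpos (n₀ * G) K (Finset.Icc (-(K : ℤ)) K)
    (fun k hk => abs_le.mpr (Finset.mem_Icc.mp hk)) p hΛ.le hedge'
  have hτsum' : ∑ i ∈ Finset.range p, τ i ≤ τtot := by
    rw [hτtot, hlam']; push_cast at hτsum; exact hτsum
  have hτ0 : ∀ i ∈ Finset.range p, 0 ≤ τ i := by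
    intro i hi
    refine le_trans (Finset.sum_nonneg fun k hk => ?_) (hτ i hi 0)
    obtain ⟨hkI, -⟩ := Finset.mem_filter.mp hk
    have hk' : |((k : ℤ) : ℝ)| ≤ K := by rw [← Int.cast_abs]; exact_mod_cast abs_le.mpr (Finset.mem_Icc.mp hkI)
    have := le_abs_self ((k : ℤ) : ℝ); have := neg_abs_le ((k : ℤ) : ℝ)
    have h1 : 0 < ((n₀ * G : ℕ) : ℝ) + k := by linarith
    have h2 : 0 < ((n₀ * G : ℕ) : ℝ) - k := by linarith
    refine mul_nonneg (mul_nonneg (Finset.sum_nonneg fun i' _ => ?_) ?_) (pow_nonneg hΛ.le _) <;> positivity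
  -- (4) the all-orders corner-trace bound on each fibre
  have hXn : ∀ n ∈ F, ∑ k₀ ∈ Wn n, ‖∑ l ∈ Sχ, χ l * mFourierCoeff b ![n, l] * fourierCoeff (g0 n) (k₀ - l)‖ ^ 2 ≤
      cA * ∑ i ∈ Finset.range p, τ i / Λ ^ (2 * i) * (pos i n + neg i n) + c₂ * e n := by
    intro n hn
    have hWn2 : ∀ k₀ ∈ Wn n, |k₀| + L + D ≤ (((n.natAbs * G : ℕ) : ℤ)) := by
      intro k₀ hk₀
      obtain ⟨k', hk'W, hk'n, rfl⟩ := hWn' n k₀ hk₀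
      rw [hnG, ← hk'n]; exact hWD k' hk'W
    have hWnK : ∀ k₀ ∈ Wn n, |k₀| ≤ (K : ℤ) := by
      intro k₀ hk₀
      obtain ⟨k', hk'W, -, rfl⟩ := hWn' n k₀ hk₀
      exact hWK k' hk'W
    have hlam : n₀ * G ≤ n.natAbs * G := by
      obtain ⟨k', hk'W, hk'n⟩ := hFW n hn
      have h1 : (n₀ : ℤ) ≤ |n| := by rw [← hk'n]; exact hWn₀ k' hk'W
      have h2 : n₀ ≤ n.natAbs := by
        have : (n₀ : ℤ) ≤ (n.natAbs : ℤ) := by rwa [Int.natCast_natAbs]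
        exact_mod_cast this
      exact Nat.mul_le_mul_right G h2
    rcases lt_trichotomy n 0 with hlt | hzero | hgt
    · have hcast : -(((n.natAbs * G : ℕ) : ℤ)) = n * G := by rw [hnG, abs_of_neg hlt]; ring
      have hg₀' : ∀ t : ℝ, g0 n (t : UnitAddCircle) = Complex.exp (-(2 * π * I * ((-(((n.natAbs * G : ℕ) : ℤ)) : ℤ) : ℂ) *
          ((tri (2 * π * P.N j * t) / (2 * π * P.N j) : ℝ) : ℂ))) := fun t => by rw [hg0t, hcast]
      have h := cornerTraceGeom_fibre_sq_le_neg hNpos hg₀' (fun l => χ l * mFourierCoeff b ![n, l]) Sχ hD hSL (Wn n) hWn2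
        hWnK hlam hp hΛ hε hedge' hτ
      beta_reduce at h
      have e1 : ∀ i, neg i n = ∑ r ∈ Finset.range (P.N j), ‖∑ l ∈ Sχ, χ l * mFourierCoeff b ![n, l] * (l : ℂ) ^ i *
          cexp (2 * π * I * l * (-((4 * (r : ℝ) - 1) / (4 * P.N j))))‖ ^ 2 +
        ∑ r ∈ Finset.range (P.N j), ‖∑ l ∈ Sχ, χ l * mFourierCoeff b ![n, l] * (l : ℂ) ^ i *
          cexp (2 * π * I * l * (-((4 * (r : ℝ) + 1) / (4 * P.N j))))‖ ^ 2 := fun i => by rw [hneg, if_pos hlt]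
      have e2 : ∀ i, pos i n = 0 := fun i => by rw [hpos, if_neg (by omega)]
      simp only [e2, zero_add]
      simp_rw [← e1] at h
      rw [← he n] at h
      rw [hcA, hc₂, hσξ, hMpdef]
      exact h
    · exact absurd hzero (hF0 n hn)
    · have hcast : (((n.natAbs * G : ℕ) : ℤ)) = n * G := by rw [hnG, abs_of_pos hgt]
      have hg₀' : ∀ t : ℝ, g0 n (t : UnitAddCircle) = Complex.exp (-(2 * π * I * ((((n.natAbs * G : ℕ) : ℤ)) : ℂ) *
          ((tri (2 * π * P.N j * t) / (2 * π * P.N j) : ℝ) : ℂ))) := fun t => by rw [hg0t, hcast]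
      have h := cornerTraceGeom_fibre_sq_le_pos hNpos hg₀' (fun l => χ l * mFourierCoeff b ![n, l]) Sχ hD hSL (Wn n) hWn2
        hWnK hlam hp hΛ hε hedge' hτ
      beta_reduce at h
      have e1 : ∀ i, pos i n = ∑ r ∈ Finset.range (P.N j), ‖∑ l ∈ Sχ, χ l * mFourierCoeff b ![n, l] * (l : ℂ) ^ i *
          cexp (2 * π * I * l * ((4 * (r : ℝ) - 1) / (4 * P.N j)))‖ ^ 2 +
        ∑ r ∈ Finset.range (P.N j), ‖∑ l ∈ Sχ, χ l * mFourierCoeff b ![n, l] * (l : ℂ) ^ i *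
          cexp (2 * π * I * l * ((4 * (r : ℝ) + 1) / (4 * P.N j)))‖ ^ 2 := fun i => by rw [hpos, if_pos hgt]
      have e2 : ∀ i, neg i n = 0 := fun i => by rw [hneg, if_neg (by omega)]
      simp only [e2, add_zero]
      simp_rw [← e1] at h
      rw [← he n] at h
      rw [hcA, hc₂, hσξ, hMpdef]
      exact h
  -- (5) the CT half-step on each fibre
  have hfib : ∀ n ∈ F, ∑ k₀ ∈ Wn n, ‖fourierCoeff (fun x : UnitAddCircle => twist Ψ n x *
        ∑ l ∈ Sχ, χ l * mFourierCoeff b ![n, l] * fourier l x) k₀‖ ^ 2 ≤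
      (Real.sqrt (cA * ∑ i ∈ Finset.range p, τ i / Λ ^ (2 * i) * (pos i n + neg i n) + c₂ * e n) +
        Real.sqrt (η ^ 2 * e n + 4 * ρ n)) ^ 2 := by
    intro n hn
    obtain ⟨k, hkW, hkn⟩ := hFW n hn
    have h := sum_window_sq_norm_fourierCoeff_mul_trigPoly_le (continuous_twist Ψ n) (hg0c n)
      (fun l => χ l * mFourierCoeff b ![n, l]) Sχ (Wn n) (hXn n hn) hZm
      (fun x hx => by rw [← hkn]; exact hoffZ k hkW x hx) (hon n)
    beta_reduce at h
    rw [← he n, ← hρ n] at h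
    exact h
  -- (6) the sums over the fibres
  have hsw : ∀ (F' : Finset ℤ) (Θ' : ℝ) (i : ℕ), (∀ y : ℝ, ∑ n ∈ F',
      ‖∑ l ∈ Sχ, χ l * (l : ℂ) ^ i * mFourierCoeff b ![n, l] * cexp (2 * π * I * l * y)‖ ^ 2 ≤ Θ') →
      ∀ w : ℕ → ℂ, (∀ r, ∃ y : ℝ, (y : ℂ) = w r) → ∑ n ∈ F', ∑ r ∈ Finset.range (P.N j),
      ‖∑ l ∈ Sχ, χ l * mFourierCoeff b ![n, l] * (l : ℂ) ^ i * cexp (2 * π * I * l * w r)‖ ^ 2 ≤ P.N j * Θ' := by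
    intro F' Θ' i hΘ' w hw
    have h := sum_traces_le_mul (N := P.N j) F' Sχ (fun l n => χ l * (l : ℂ) ^ i * mFourierCoeff b ![n, l]) hΘ' w hw
    refine le_of_eq_of_le (Finset.sum_congr rfl fun n _ => Finset.sum_congr rfl fun r _ => ?_) h
    congr 2
    exact Finset.sum_congr rfl fun l _ => by ring
  have hposF : ∀ i ∈ Finset.range p, ∑ n ∈ F, pos i n ≤ 2 * (P.N j * (Λ ^ (2 * i) * Θp)) := by
    intro i hi
    simp only [hpos]
    rw [← Finset.sum_filter, Finset.sum_add_distrib]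
    have h1 := hsw _ _ i (hΘp i hi) (fun r => ((4 * (r : ℝ) - 1) / (4 * P.N j) : ℂ))
      (fun r => ⟨(4 * (r : ℝ) - 1) / (4 * P.N j), by push_cast; ring⟩)
    have h2 := hsw _ _ i (hΘp i hi) (fun r => ((4 * (r : ℝ) + 1) / (4 * P.N j) : ℂ))
      (fun r => ⟨(4 * (r : ℝ) + 1) / (4 * P.N j), by push_cast; ring⟩)
    beta_reduce at h1 h2; linarith
  have hnegF : ∀ i ∈ Finset.range p, ∑ n ∈ F, neg i n ≤ 2 * (P.N j * (Λ ^ (2 * i) * Θm)) := by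
    intro i hi
    simp only [hneg]
    rw [← Finset.sum_filter, Finset.sum_add_distrib]
    have h1 := hsw _ _ i (hΘm i hi) (fun r => (-((4 * (r : ℝ) - 1) / (4 * P.N j)) : ℂ))
      (fun r => ⟨-((4 * (r : ℝ) - 1) / (4 * P.N j)), by push_cast; ring⟩)
    have h2 := hsw _ _ i (hΘm i hi) (fun r => (-((4 * (r : ℝ) + 1) / (4 * P.N j)) : ℂ))
      (fun r => ⟨-((4 * (r : ℝ) + 1) / (4 * P.N j)), by push_cast; ring⟩)
    beta_reduce at h1 h2; linarith
  have heF : ∑ n ∈ F, e n ≤ E := by simp only [he]; exact hE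
  have hρF : ∑ n ∈ F, ρ n ≤ 2 * M * P.δ j / π * (Θp + Θm) := by
    simp only [hρ]
    have hint : ∀ n ∈ F, Integrable (fun x : UnitAddCircle =>
        ‖∑ l ∈ Sχ, χ l * mFourierCoeff b ![n, l] * (fourier l x : ℂ)‖ ^ 2) (volume.restrict Z) := fun n _ =>
      (hI ((continuous_norm.comp (continuous_finsetSum _ fun l _ =>
        continuous_const.mul (fourier l).continuous)).pow 2)).restrict
    rw [← integral_finsetSum F hint]
    have hle : ∀ x ∈ Z, ‖∑ n ∈ F, ‖∑ l ∈ Sχ, χ l * mFourierCoeff b ![n, l] * (fourier l x : ℂ)‖ ^ 2‖ ≤ Θp + Θm := by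
      intro x _
      obtain ⟨y, rfl⟩ := QuotientAddGroup.mk_surjective x
      have ey : (QuotientAddGroup.mk y : UnitAddCircle) = ((y : ℝ) : UnitAddCircle) := rfl
      rw [ey, Real.norm_of_nonneg (Finset.sum_nonneg fun n _ => sq_nonneg _), hFsplit]
      simp only [fourier_coe_apply_one]
      exact add_le_add (hΘp0 y) (hΘm0 y)
    have h := norm_setIntegral_le_of_norm_le_const (measure_lt_top volume Z) hle
    refine ((le_abs_self _).trans ((Real.norm_eq_abs _).symm.le.trans h)).trans ?_
    calc (Θp + Θm) * volume.real Z ≤ (Θp + Θm) * (2 * M * P.δ j / π) := mul_le_mul_of_nonneg_left hZvol hΘ0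
      _ = 2 * M * P.δ j / π * (Θp + Θm) := by ring
  -- (7) the tracked part
  have hA : ∑ n ∈ F, (cA * ∑ i ∈ Finset.range p, τ i / Λ ^ (2 * i) * (pos i n + neg i n) + c₂ * e n) ≤
      c₁ * (Θp + Θm) + c₂ * E := by
    rw [Finset.sum_add_distrib, ← Finset.mul_sum, ← Finset.mul_sum, Finset.sum_comm]
    have h1 : ∀ i ∈ Finset.range p, ∑ n ∈ F, τ i / Λ ^ (2 * i) * (pos i n + neg i n) ≤ τ i * (2 * P.N j * (Θp + Θm)) := by
      intro i hi
      rw [← Finset.mul_sum, Finset.sum_add_distrib]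
      have hΛi : 0 < Λ ^ (2 * i) := pow_pos hΛ _
      have h3 : τ i / Λ ^ (2 * i) * (∑ n ∈ F, pos i n + ∑ n ∈ F, neg i n) ≤
          τ i / Λ ^ (2 * i) * (2 * (P.N j * (Λ ^ (2 * i) * Θp)) + 2 * (P.N j * (Λ ^ (2 * i) * Θm))) :=
        mul_le_mul_of_nonneg_left (add_le_add (hposF i hi) (hnegF i hi)) (div_nonneg (hτ0 i hi) hΛi.le)
      refine h3.trans (le_of_eq ?_)
      field_simp
    have h2 : cA * ∑ i ∈ Finset.range p, ∑ n ∈ F, τ i / Λ ^ (2 * i) * (pos i n + neg i n) ≤ c₁ * (Θp + Θm) := by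
      calc cA * ∑ i ∈ Finset.range p, ∑ n ∈ F, τ i / Λ ^ (2 * i) * (pos i n + neg i n)
          ≤ cA * ∑ i ∈ Finset.range p, τ i * (2 * P.N j * (Θp + Θm)) :=
            mul_le_mul_of_nonneg_left (Finset.sum_le_sum h1) hcA0
        _ = cA * (2 * P.N j * (Θp + Θm)) * ∑ i ∈ Finset.range p, τ i := by rw [← Finset.sum_mul]; ring
        _ ≤ cA * (2 * P.N j * (Θp + Θm)) * τtot := mul_le_mul_of_nonneg_left hτsum' (by positivity)
        _ = c₁ * (Θp + Θm) := by rw [hc₁, hcA]; field_simp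
    have h4 : c₂ * ∑ n ∈ F, e n ≤ c₂ * E := mul_le_mul_of_nonneg_left heF hc₂0
    linarith
  have hB : ∑ n ∈ F, (η ^ 2 * e n + 4 * ρ n) ≤ η ^ 2 * E + 8 * M * P.δ j / π * (Θp + Θm) := by
    rw [Finset.sum_add_distrib, ← Finset.mul_sum, ← Finset.mul_sum]
    have h1 : η ^ 2 * ∑ n ∈ F, e n ≤ η ^ 2 * E := mul_le_mul_of_nonneg_left heF (sq_nonneg _)
    have h2 : 4 * ∑ n ∈ F, ρ n ≤ 4 * (2 * M * P.δ j / π * (Θp + Θm)) := by linarith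
    have h3 : 4 * (2 * M * P.δ j / π * (Θp + Θm)) = 8 * M * P.δ j / π * (Θp + Θm) := by ring
    linarith
  have hTpart : ∑ k ∈ W, ‖mFourierCoeff (T ∘ shearMap 0 1 Ψ) k‖ ^ 2 ≤
      (Real.sqrt (c₁ * (Θp + Θm) + c₂ * E) + Real.sqrt (η ^ 2 * E + 8 * M * P.δ j / π * (Θp + Θm))) ^ 2 := by
    rw [hTsum]
    have h1 := Finset.sum_le_sum hfib
    have h2 := SpectralLeakage.sqrt_sum_add_sq_le F (a := fun n => Real.sqrt (cA * ∑ i ∈ Finset.range p, τ i / Λ ^ (2 * i) * (pos i n + neg i n) + c₂ * e n))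
      (b := fun n => Real.sqrt (η ^ 2 * e n + 4 * ρ n)) (fun n _ => Real.sqrt_nonneg _) (fun n _ => Real.sqrt_nonneg _)
    have h3 : ∑ n ∈ F, Real.sqrt (cA * ∑ i ∈ Finset.range p, τ i / Λ ^ (2 * i) * (pos i n + neg i n) + c₂ * e n) ^ 2 = ∑ n ∈ F, (cA * ∑ i ∈ Finset.range p, τ i / Λ ^ (2 * i) * (pos i n + neg i n) + c₂ * e n) :=
      Finset.sum_congr rfl fun n _ => Real.sq_sqrt (by
        have := he0 n
        have : 0 ≤ cA * ∑ i ∈ Finset.range p, τ i / Λ ^ (2 * i) * (pos i n + neg i n) :=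
          mul_nonneg hcA0 (Finset.sum_nonneg fun i hi => mul_nonneg (div_nonneg (hτ0 i hi) (pow_nonneg hΛ.le _))
            (add_nonneg (hpos0 i n) (hneg0 i n)))
        positivity)
    have h4 : ∑ n ∈ F, Real.sqrt (η ^ 2 * e n + 4 * ρ n) ^ 2 = ∑ n ∈ F, (η ^ 2 * e n + 4 * ρ n) :=
      Finset.sum_congr rfl fun n _ => Real.sq_sqrt (by have := he0 n; have := hρ0 n; positivity)
    rw [h3, h4] at h2
    have h0 : 0 ≤ ∑ n ∈ F, (Real.sqrt (cA * ∑ i ∈ Finset.range p, τ i / Λ ^ (2 * i) * (pos i n + neg i n) + c₂ * e n) + Real.sqrt (η ^ 2 * e n + 4 * ρ n)) ^ 2 :=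
      Finset.sum_nonneg fun n _ => sq_nonneg _
    calc _ ≤ _ := h1
      _ = (Real.sqrt (∑ n ∈ F, (Real.sqrt (cA * ∑ i ∈ Finset.range p, τ i / Λ ^ (2 * i) * (pos i n + neg i n) + c₂ * e n) +
            Real.sqrt (η ^ 2 * e n + 4 * ρ n)) ^ 2)) ^ 2 := (Real.sq_sqrt h0).symm
      _ ≤ (Real.sqrt (∑ n ∈ F, (cA * ∑ i ∈ Finset.range p, τ i / Λ ^ (2 * i) * (pos i n + neg i n) + c₂ * e n)) +
            Real.sqrt (∑ n ∈ F, (η ^ 2 * e n + 4 * ρ n))) ^ 2 := pow_le_pow_left₀ (Real.sqrt_nonneg _) h2 2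
      _ ≤ _ := pow_le_pow_left₀ (by positivity)
            (add_le_add (Real.sqrt_le_sqrt hA) (Real.sqrt_le_sqrt hB)) 2
  rw [hc₁, hc₂, hτtot, hσξ, hMpdef, hlam'] at hTpart
  exact hTpart

end Summit.AnomalousDissipation.AnomalousDissipation.Theorems.SawtoothPulseCascade.K1Window
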